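import Mathlib
import HarnessLib
import Literature.MathematicalPhysics.QuantumLattice.HubbardCounterQuadraticResummation
import Literature.MathematicalPhysics.QuantumLattice.HubbardUVSymbolCTDifferences
import Summits.HubbardSuperconductivity.HubbardSuperconductivity.Theorems.KLProgrammeKLRegimeEngineScaleZeroResummedDecayTorus
import Summits.HubbardSuperconductivity.HubbardSuperconductivity.Theorems.KLProgrammeKLRegimeEngineScaleZeroResummedDecayKlEng

/-!
# K3 engine (gen-6 item `KLRegimeEngineV16`, stmt-HubbardSuperconductivity-20236), stub `stub_twoLeg_scale0` under (ρ2): the decay constants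
# of the K-RESUMMED scale-`0` covariance `C̃^K_{>e₀} = normalCovariance Ψ̃` ON THE GRID, by name

Cell gate-hubbard-kl, seat p3 g8 ((ρ2)(iii)-DECAY, part 4: the literal object).  k3c5-p1's K-resummed representation
(`HubbardCounterQuadraticResummation`, `…TwoLegResummedChain`, `…EngineScaleZeroResummedCovariance`) runs the scale-`0` step on the grid
covariance `S_Nᵀ · normalCovariance Ψ̃ · S_N`, `Ψ̃ = Ψ/(1 + Ψ·κ)`, `Ψ = uvSymbolCT L M β μ K klE0`, `κ_k = K(p_k⃗)/(βL²)`, `S_N = hubbardGridSub L M β (4M)`,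
and has landed its Gram constant (`isGramBoundedR_scaleZero_resummed_of_frameOK`).  This file lands the other covariance input of the step —
the (unweighted) pinned row / column sums — for THAT LITERAL MATRIX, with no symbol analysis of `Ψ̃`:

  `normalCovariance Ψ̃ = M_T · C^K_{>e₀}`, `M_T = diagonal((1 + Ψκ)⁻¹)`, `M_T·(1 + C^K_{>e₀}·S_K) = 1`
  (`diagonal_mul_one_add_normalCovariance_mul_normalCovariance_neg`, `counterS_eq_normalCovariance`, `hubbardCovAboveCT_zero_seed_eq_…`),
  `S_Nᵀ·(M_T·C)·S_N = M'·(S_NᵀCS_N)` (part 2, push-through + transport), `hrow(M'·G) ≤ 2·(N/β)·klScaleZeroA0` below `klEngU₀3` (part 3).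

* **`rowSum_gridSub_resummedNormalCov_le_of_klEng` / `colSum_…`** — `FrameOK R U Nsc μ K`, `R.WF`, `klBetaMin ≤ β`, `β³ ≤ M`,
  `0 < U ≤ klEngU₀3 P R c`, `1 + Ψκ ≠ 0` ⇒ `Σ_Y ‖(S_Nᵀ·normalCovariance Ψ̃·S_N) X Y‖ ≤ 2·((4M)/β)·klScaleZeroA0` (and columns): the plain
  decay constant `α̃` of the K-resummed covariance is twice the bare one;
* `rowSum_gridSub_resummedNormalCov_mul_gridLabelWt_le` — the WEIGHTED twin (`gridLabelWt`) modulo the bare weighted constant `α_w` of (E4)₀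
  and the smallness `α_w·ν_w ≤ 1/2` (`ν_w` of part 1 at the frame), both left as hypotheses until `α_w` is a closed term.

Everything is proved; no definitions, no named facts, no sorry.  `--supports stmt-HubbardSuperconductivity-20236` (helper).
-/

noncomputable section

namespace Summit.HubbardSuperconductivity.HubbardSuperconductivity.Theorems.EngineV8

set_option linter.dupNamespace false -- summit = problem name (single-conjunct summit), D-0017

open Real Finset Literature.MathematicalPhysics.QuantumLattice Literature.Probability.LatticeModels
open Summit.HubbardSuperconductivity.HubbardSuperconductivity.Theorems.KLRegimeSplit
open Summit.HubbardSuperconductivity.HubbardSuperconductivity.Theorems.KLProgrammeLegKernels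
open Summit.HubbardSuperconductivity.HubbardSuperconductivity.Theorems.ScaleZeroDecay
open scoped Matrix

section Normal

variable {L M : ℕ} [NeZero L] [NeZero M] {P : SplitConsts} {R : RenConsts} {c U β μ : ℝ} {Nsc : ℕ} {K : TrigPolyC4v}

omit [NeZero M] in
/-- **The K-resummed scale-`0` covariance as the dressed CT covariance**: with `Ψ = uvSymbolCT … K klE0`, `κ_k = K(p_k⃗)/(βL²)` and
`1 + Ψκ ≠ 0`, `normalCovariance Ψ̃ = diagonal((1 + Ψκ)⁻¹) · C^K_{>e₀}` and `diagonal((1 + Ψκ)⁻¹)·(1 + C^K_{>e₀}·S_K) = 1` for the literal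
antisymmetrised torus counterterm matrix `S_K`. -/
theorem resummedNormalCov_eq_diagonal_mul (β μ : ℝ) (K : TrigPolyC4v)
    (hden : ∀ ks : FreqMomentum L M × Fin 2,
      1 + uvSymbolCT L M β μ K klE0 ks * (((K.eval (latticeMomentum L ks.1.2) / (β * (L : ℝ) ^ 2) : ℝ)) : ℂ) ≠ 0) :
    normalCovariance L M (fun ks => uvSymbolCT L M β μ K klE0 ks /
        (1 + uvSymbolCT L M β μ K klE0 ks * ((K.eval (latticeMomentum L ks.1.2) / (β * (L : ℝ) ^ 2) : ℝ) : ℂ))) =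
      (Matrix.diagonal fun X : HubbardFieldIdx L M =>
          (1 + uvSymbolCT L M β μ K klE0 X.1 * (((K.eval (latticeMomentum L X.1.1.2) / (β * (L : ℝ) ^ 2) : ℝ)) : ℂ))⁻¹) *
        hubbardCovAboveCT L M β μ 0 K klE0 ∧
    (Matrix.diagonal fun X : HubbardFieldIdx L M =>
          (1 + uvSymbolCT L M β μ K klE0 X.1 * (((K.eval (latticeMomentum L X.1.1.2) / (β * (L : ℝ) ^ 2) : ℝ)) : ℂ))⁻¹) *
        (1 + hubbardCovAboveCT L M β μ 0 K klE0 * (Matrix.of fun X Y : HubbardFieldIdx L M =>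
          (Matrix.of fun Z W : HubbardFieldIdx L M =>
              if Z.2 = 0 ∧ W = (Z.1, 1) then -(((K.eval (latticeMomentum L Z.1.1.2) / (β * (L : ℝ) ^ 2) : ℝ) : ℂ)) else 0) X Y -
            (Matrix.of fun Z W : HubbardFieldIdx L M =>
              if Z.2 = 0 ∧ W = (Z.1, 1) then -(((K.eval (latticeMomentum L Z.1.1.2) / (β * (L : ℝ) ^ 2) : ℝ) : ℂ)) else 0) Y X)) = 1 := by
  have hC : hubbardCovAboveCT L M β μ 0 K klE0 = normalCovariance L M (uvSymbolCT L M β μ K klE0) :=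
    hubbardCovAboveCT_zero_seed_eq_normalCovariance_uvSymbolCT β μ K klE0
  -- the literal antisymmetrised counterterm matrix is the normal-form matrix of `-κ`
  have hS : (Matrix.of fun X Y : HubbardFieldIdx L M =>
        (Matrix.of fun Z W : HubbardFieldIdx L M =>
            if Z.2 = 0 ∧ W = (Z.1, 1) then -(((K.eval (latticeMomentum L Z.1.1.2) / (β * (L : ℝ) ^ 2) : ℝ) : ℂ)) else 0) X Y -
          (Matrix.of fun Z W : HubbardFieldIdx L M =>
            if Z.2 = 0 ∧ W = (Z.1, 1) then -(((K.eval (latticeMomentum L Z.1.1.2) / (β * (L : ℝ) ^ 2) : ℝ) : ℂ)) else 0) Y X) =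
      normalCovariance L M (fun ks => -(((K.eval (latticeMomentum L ks.1.2) / (β * (L : ℝ) ^ 2) : ℝ)) : ℂ)) :=
    counterS_eq_normalCovariance (L := L) (M := M) (fun ks => (((K.eval (latticeMomentum L ks.1.2) / (β * (L : ℝ) ^ 2) : ℝ)) : ℂ))
  refine ⟨?_, ?_⟩
  · rw [hC]
    refine Eq.trans ?_ (diagonal_mul_normalCovariance (fun ks => (1 + uvSymbolCT L M β μ K klE0 ks *
      (((K.eval (latticeMomentum L ks.1.2) / (β * (L : ℝ) ^ 2) : ℝ)) : ℂ))⁻¹) (uvSymbolCT L M β μ K klE0)).symm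
    congr 1
    funext ks
    show _ = (1 + uvSymbolCT L M β μ K klE0 ks * (((K.eval (latticeMomentum L ks.1.2) / (β * (L : ℝ) ^ 2) : ℝ)) : ℂ))⁻¹ *
      uvSymbolCT L M β μ K klE0 ks
    rw [div_eq_mul_inv, mul_comm]
  · rw [hS, hC]
    exact diagonal_mul_one_add_normalCovariance_mul_normalCovariance_neg (uvSymbolCT L M β μ K klE0)
      (fun ks => (((K.eval (latticeMomentum L ks.1.2) / (β * (L : ℝ) ^ 2) : ℝ)) : ℂ)) hden

/-- **Unweighted row sums of the K-resummed scale-`0` covariance on the grid, at the engine's package**: for an admissible frame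
(`FrameOK R U Nsc μ K`, `R.WF`), `klBetaMin ≤ β`, `β³ ≤ M`, `0 < U ≤ klEngU₀3 P R c`, and `1 + Ψκ ≠ 0` (always true for a real frame,
`…TwoLegResummedChainDen`): `Σ_Y ‖(S_Nᵀ · normalCovariance Ψ̃ · S_N) X Y‖ ≤ 2·((4M)/β)·klScaleZeroA0` — the `hrow` of the K-resummed W-chain. -/
theorem rowSum_gridSub_resummedNormalCov_le_of_klEng (hR : R.WF) (hK : FrameOK R U Nsc μ K) (hβ : klBetaMin ≤ β)
    (hβM : β ^ 3 ≤ (M : ℝ)) (hU : 0 < U) (hU₀ : U ≤ klEngU₀3 P R c)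
    (hden : ∀ ks : FreqMomentum L M × Fin 2,
      1 + uvSymbolCT L M β μ K klE0 ks * (((K.eval (latticeMomentum L ks.1.2) / (β * (L : ℝ) ^ 2) : ℝ)) : ℂ) ≠ 0)
    (X : GridLeg (GridPoint L (2 * (2 * M)))) :
    ∑ Y, ‖((hubbardGridSub L M β (2 * (2 * M))).transpose *
        normalCovariance L M (fun ks => uvSymbolCT L M β μ K klE0 ks /
          (1 + uvSymbolCT L M β μ K klE0 ks * ((K.eval (latticeMomentum L ks.1.2) / (β * (L : ℝ) ^ 2) : ℝ) : ℂ))) *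
        hubbardGridSub L M β (2 * (2 * M))) X Y‖ ≤ 2 * ((((2 * (2 * M) : ℕ) : ℝ)) / β * klScaleZeroA0) := by
  have hβ0 : 0 < β := beta_pos_of_klBetaMin_le hβ
  have hMN : 2 * M ≤ 2 * (2 * M) := by omega
  obtain ⟨hMC, hMT⟩ := resummedNormalCov_eq_diagonal_mul (L := L) (M := M) β μ K hden
  -- the grid dressing `M' = (1 + G·S_g)⁻¹`
  have hS := norm_neg_gridCounterAnti_le (L := L) (N := 2 * (2 * M)) β K
  have hunit := isUnit_one_add_scaleZeroCov_mul_of_klEng (μ := μ) hR hK hβ hβM hU hU₀ hS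
  have hM' := Matrix.nonsing_inv_mul _ ((Matrix.isUnit_iff_isUnit_det _).1 hunit)
  rw [hMC, gridSub_transpose_mul_resummed_mul_gridSub hβ0.ne' hMN hMT hM']
  exact rowSum_resummedScaleZeroCov_le_of_klEng hR hK hβ hβM hU hU₀ hS hM' X

/-- **Unweighted column sums of the K-resummed scale-`0` covariance on the grid, at the engine's package**: `≤ 2·((4M)/β)·klScaleZeroA0`. -/
theorem colSum_gridSub_resummedNormalCov_le_of_klEng (hR : R.WF) (hK : FrameOK R U Nsc μ K) (hβ : klBetaMin ≤ β)
    (hβM : β ^ 3 ≤ (M : ℝ)) (hU : 0 < U) (hU₀ : U ≤ klEngU₀3 P R c)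
    (hden : ∀ ks : FreqMomentum L M × Fin 2,
      1 + uvSymbolCT L M β μ K klE0 ks * (((K.eval (latticeMomentum L ks.1.2) / (β * (L : ℝ) ^ 2) : ℝ)) : ℂ) ≠ 0)
    (Y : GridLeg (GridPoint L (2 * (2 * M)))) :
    ∑ X, ‖((hubbardGridSub L M β (2 * (2 * M))).transpose *
        normalCovariance L M (fun ks => uvSymbolCT L M β μ K klE0 ks /
          (1 + uvSymbolCT L M β μ K klE0 ks * ((K.eval (latticeMomentum L ks.1.2) / (β * (L : ℝ) ^ 2) : ℝ) : ℂ))) *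
        hubbardGridSub L M β (2 * (2 * M))) X Y‖ ≤ 2 * ((((2 * (2 * M) : ℕ) : ℝ)) / β * klScaleZeroA0) := by
  have hβ0 : 0 < β := beta_pos_of_klBetaMin_le hβ
  have hMN : 2 * M ≤ 2 * (2 * M) := by omega
  obtain ⟨hMC, hMT⟩ := resummedNormalCov_eq_diagonal_mul (L := L) (M := M) β μ K hden
  have hS := norm_neg_gridCounterAnti_le (L := L) (N := 2 * (2 * M)) β K
  have hunit := isUnit_one_add_scaleZeroCov_mul_of_klEng (μ := μ) hR hK hβ hβM hU hU₀ hS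
  have hM' := Matrix.nonsing_inv_mul _ ((Matrix.isUnit_iff_isUnit_det _).1 hunit)
  rw [hMC, gridSub_transpose_mul_resummed_mul_gridSub hβ0.ne' hMN hMT hM']
  exact colSum_resummedScaleZeroCov_le_of_klEng hR hK hβ hβM hU hU₀ hS hM' Y

/-- **Door to the registered binder** `0 < U ≤ klEngU₀4 P R c` (rows). -/
theorem rowSum_gridSub_resummedNormalCov_le_of_klEngU₀4 (hR : R.WF) (hK : FrameOK R U Nsc μ K) (hβ : klBetaMin ≤ β)
    (hβM : β ^ 3 ≤ (M : ℝ)) (hU : 0 < U) (hU₀ : U ≤ klEngU₀4 P R c)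
    (hden : ∀ ks : FreqMomentum L M × Fin 2,
      1 + uvSymbolCT L M β μ K klE0 ks * (((K.eval (latticeMomentum L ks.1.2) / (β * (L : ℝ) ^ 2) : ℝ)) : ℂ) ≠ 0)
    (X : GridLeg (GridPoint L (2 * (2 * M)))) :
    ∑ Y, ‖((hubbardGridSub L M β (2 * (2 * M))).transpose *
        normalCovariance L M (fun ks => uvSymbolCT L M β μ K klE0 ks /
          (1 + uvSymbolCT L M β μ K klE0 ks * ((K.eval (latticeMomentum L ks.1.2) / (β * (L : ℝ) ^ 2) : ℝ) : ℂ))) *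
        hubbardGridSub L M β (2 * (2 * M))) X Y‖ ≤ 2 * ((((2 * (2 * M) : ℕ) : ℝ)) / β * klScaleZeroA0) :=
  rowSum_gridSub_resummedNormalCov_le_of_klEng hR hK hβ hβM hU (hU₀.trans (klEngU₀4_le_klEngU₀3 P R c)) hden X

/-- **Door to the registered binder** `0 < U ≤ klEngU₀4 P R c` (columns). -/
theorem colSum_gridSub_resummedNormalCov_le_of_klEngU₀4 (hR : R.WF) (hK : FrameOK R U Nsc μ K) (hβ : klBetaMin ≤ β)
    (hβM : β ^ 3 ≤ (M : ℝ)) (hU : 0 < U) (hU₀ : U ≤ klEngU₀4 P R c)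
    (hden : ∀ ks : FreqMomentum L M × Fin 2,
      1 + uvSymbolCT L M β μ K klE0 ks * (((K.eval (latticeMomentum L ks.1.2) / (β * (L : ℝ) ^ 2) : ℝ)) : ℂ) ≠ 0)
    (Y : GridLeg (GridPoint L (2 * (2 * M)))) :
    ∑ X, ‖((hubbardGridSub L M β (2 * (2 * M))).transpose *
        normalCovariance L M (fun ks => uvSymbolCT L M β μ K klE0 ks /
          (1 + uvSymbolCT L M β μ K klE0 ks * ((K.eval (latticeMomentum L ks.1.2) / (β * (L : ℝ) ^ 2) : ℝ) : ℂ))) *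
        hubbardGridSub L M β (2 * (2 * M))) X Y‖ ≤ 2 * ((((2 * (2 * M) : ℕ) : ℝ)) / β * klScaleZeroA0) :=
  colSum_gridSub_resummedNormalCov_le_of_klEng hR hK hβ hβM hU (hU₀.trans (klEngU₀4_le_klEngU₀3 P R c)) hden Y

/-- **The weighted twin** (`gridLabelWt`, the (E4)₀ pair weight): if the bare pulled-back covariance `S_NᵀC^K_{>e₀}S_N` has weighted row sums
`≤ α_w` and `α_w·ν ≤ 1/2` with `ν = (β/(4M))·(κ_R·|U| + 2(Nsc+1)U²·m_R)` the frame's weighted profile bound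
(`sum_norm_framePosKernel_mul_weight_le_of_frameOK`), then the K-resummed covariance has weighted row sums `≤ 2α_w`
(`klBetaMin ≤ β`, `0 < |U| ≤ 1`, `1 + Ψκ ≠ 0`, `0 ≤ α_w`). -/
theorem rowSum_gridSub_resummedNormalCov_mul_gridLabelWt_le (hR : R.WF) (hK : FrameOK R U Nsc μ K) (hβ : klBetaMin ≤ β)
    (hU : U ≠ 0) (hU1 : |U| ≤ 1)
    (hden : ∀ ks : FreqMomentum L M × Fin 2,
      1 + uvSymbolCT L M β μ K klE0 ks * (((K.eval (latticeMomentum L ks.1.2) / (β * (L : ℝ) ^ 2) : ℝ)) : ℂ) ≠ 0)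
    {αw : ℝ} (hα : 0 ≤ αw)
    (hG : ∀ X, ∑ Y, ‖((hubbardGridSub L M β (2 * (2 * M))).transpose * hubbardCovAboveCT L M β μ 0 K klE0 *
      hubbardGridSub L M β (2 * (2 * M))) X Y‖ * gridLabelWt L (2 * (2 * M)) β {gridLegPos X, gridLegPos Y} ≤ αw)
    (hαν : αw * (|β| / (((2 * (2 * M) : ℕ) : ℝ)) *
      (256 * ((4 / 3) * Real.sqrt (24 * π ^ 2 * (R.Gfr 0 + 1) * (R.Gfr 2 + 1)) + (128 / 15) * (R.Gfr 0 + 1)) * |U| +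
        2 * (((Nsc : ℝ) + 1) * U ^ 2 * (6 * (Real.pi * R.Gfr 1 / 2 + Real.pi ^ 2 * R.Gfr 2 / (2 * Real.sqrt 2) + Real.pi ^ 3 * R.Gfr 3 / 8))))) ≤ 1 / 2)
    (X : GridLeg (GridPoint L (2 * (2 * M)))) :
    ∑ Y, ‖((hubbardGridSub L M β (2 * (2 * M))).transpose *
        normalCovariance L M (fun ks => uvSymbolCT L M β μ K klE0 ks /
          (1 + uvSymbolCT L M β μ K klE0 ks * ((K.eval (latticeMomentum L ks.1.2) / (β * (L : ℝ) ^ 2) : ℝ) : ℂ))) *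
        hubbardGridSub L M β (2 * (2 * M))) X Y‖ * gridLabelWt L (2 * (2 * M)) β {gridLegPos X, gridLegPos Y} ≤ 2 * αw := by
  have hβ0 : 0 < β := beta_pos_of_klBetaMin_le hβ
  have hMN : 2 * M ≤ 2 * (2 * M) := by omega
  obtain ⟨hMC, hMT⟩ := resummedNormalCov_eq_diagonal_mul (L := L) (M := M) β μ K hden
  rw [hMC]
  exact rowSum_gridSub_resummed_le_two_mul hβ0.ne' hMN hβ0.le hMT hG
    (mul_le_mul_of_nonneg_left (sum_norm_framePosKernel_mul_weight_le_of_frameOK hR hU hU1 hK) (by positivity)) hα hαν X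

end Normal

end Summit.HubbardSuperconductivity.HubbardSuperconductivity.Theorems.EngineV8

end
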